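import Literature.Algebra.Homology.FiniteCyclicGroupHomology
import Mathlib.RepresentationTheory.Coinduced
import Mathlib.GroupTheory.Coset.Basic
import HarnessLib

/-!
# Shapiro's lemma in Tate degree `0`: `(Coind_S^G B)^G / N_G ≅ B^S / N_S`
# (Brown VI (5.2) in degree `0`) — the algebra on Mathlib's `Rep.coind`

Topic `Algebra/Homology`; namespace `Literature.Algebra.Homology.CoindShapiro`.  Imports the lane
file `FiniteCyclicGroupHomology` (the norm map `N̄ : M_G → M^G`, `coker N̄ = M^G/NM = Ĥ⁰(G, M)`)
and Mathlib's coinduced representation `Rep.coind`; definitions with bodies and theorems; NO named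
fact, no `sorry`.  Lane `lit-hodgefound` (Track 2), seat p30 gen 15, row g15-#14 of
`run/shared/lean/pub/lit-hodgefound/SKELETON.md`.

Source followed.  K. S. Brown, *Cohomology of Groups*, GTM 87 (1982) [held copy
`book:brown1982-cohomology-groups`], VI §5 [chunk p0141–p0142]: "**(5.2)** If `H ⊆ G` and `M` is
an `H`-module, then `Ĥ*(H, M) ≈ Ĥ*(G, ℤG ⊗_{ℤH} M)`" (Shapiro's lemma for Tate cohomology; for `G`
finite `ℤG ⊗_{ℤH} M ≅ Hom_{ℤH}(ℤG, M) = Coind_H^G M`, Brown III (5.9)), together with VI §4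
[chunk p0141] "`Ĥ⁰(G, M) = coker N̄ = M^G / N M`".  In degree `0` the isomorphism is explicit and
this file proves it by hand on Mathlib's carrier `Rep.coind S.subtype B` (functions `f : G → B`
with `f(s x) = s · f(x)`, `G` acting by `(g f)(x) = f(x g)`): evaluation at `1` identifies
`(Coind_S^G B)^G` with `B^S` and carries `N_G(Coind_S^G B)` onto `N_S(B)`.

## What is formalised  (`k` a commutative ring, `G` a finite group, `S ≤ G`, `B : Rep k S`)

* §1 `evalOneInvariants : (Coind_S^G B)^G →ₗ[k] B^S` (`f ↦ f(1)`) and `constInvariants`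
  (`b ↦` the constant function), inverse to each other: **`invariantsCoindEquiv :
  (Coind_S^G B)^G ≃ₗ[k] B^S`**.
* §2 the norm computation: `coind_norm_apply_one` (`(N_G f)(1) = Σ_{g ∈ G} f(g)`),
  **`sum_apply_eq_norm`** (`Σ_{g ∈ G} f(g) = N_S (Σ_{q ∈ G/S} f(q̄⁻¹))`, `q̄` a representative — the
  coset-by-coset evaluation of the sum using `f(s x) = s f(x)`), the function `indicatorCoind b`
  supported on `S` (`x ↦ x · b` on `S`, `0` off `S`) with `Σ_g (indicatorCoind b)(g) = N_S b`.
* §3 `map_invariantsCoindEquiv_range_normBar` (evaluation at `1` carries `range N̄_G` onto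
  `range N̄_S`) and **`cokerNormBarCoindEquiv : (Coind_S^G B)^G ⧸ range N̄ ≃ₗ[k] B^S ⧸ range N̄`**
  — `Ĥ⁰(G, Coind_S^G B) ≅ Ĥ⁰(S, B)` on the `coker N̄` carriers (the `tateCohomology` form follows
  with the lane file `TateCohomologyNormMap`).

Not here: negative and positive degrees of (5.2) (positive degrees are Mathlib's
`groupCohomology.coindIso`; `n ≤ -2` the tree's `groupHomologyCoindIso`), the `Ind` form.

## References
* K. S. Brown, *Cohomology of Groups*, GTM 87, Springer (1982), VI (5.2) with VI §4 and III (5.9),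
  (6.2). [Brown1982CohomologyGroups]
-/

noncomputable section

open CategoryTheory

universe u

namespace Literature.Algebra.Homology

namespace CoindShapiro

variable {k G : Type u} [CommRing k] [Group G] (S : Subgroup G) (B : Rep.{u} k S)

/-! ## §1 `(Coind_S^G B)^G ≅ B^S` by evaluation at `1` -/

/-- The right-translation action on `Coind_S^G B`: `(g · f)(x) = f(x g)`. [folklore] -/
private theorem coind_ρ_apply (g x : G) (f : Rep.coind S.subtype B) :
    (((Rep.coind S.subtype B).ρ g f : Rep.coind S.subtype B) : G → B) x = (f : G → B) (x * g) :=
  rfl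

/-- The coinduction condition: `f(s x) = s · f(x)`. [folklore] -/
private theorem coind_apply_mul (f : Rep.coind S.subtype B) (s : S) (x : G) :
    (f : G → B) (s * x) = B.ρ s ((f : G → B) x) :=
  f.2 s x

/-- A `G`-invariant element of `Coind_S^G B` is a constant function. [cite: Brown1982CohomologyGroups, VI (5.2)] -/
theorem coind_apply_eq_apply_one_of_mem_invariants {f : Rep.coind S.subtype B}
    (hf : f ∈ (Rep.coind S.subtype B).ρ.invariants) (x : G) :
    (f : G → B) x = (f : G → B) 1 := by
  have h := congrArg (fun φ : Rep.coind S.subtype B => (φ : G → B) 1) (hf x)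
  simpa [coind_ρ_apply] using h

/-- The value at `1` of a `G`-invariant element of `Coind_S^G B` is `S`-invariant.
[cite: Brown1982CohomologyGroups, VI (5.2)] -/
theorem apply_one_mem_invariants {f : Rep.coind S.subtype B}
    (hf : f ∈ (Rep.coind S.subtype B).ρ.invariants) :
    (f : G → B) 1 ∈ B.ρ.invariants := fun s => by
  have h1 : (f : G → B) ((s : G) * 1) = B.ρ s ((f : G → B) 1) := coind_apply_mul S B f s 1
  rw [← h1]
  exact coind_apply_eq_apply_one_of_mem_invariants S B hf _

/-- **Evaluation at `1`: `(Coind_S^G B)^G → B^S`.** [cite: Brown1982CohomologyGroups, VI (5.2)] -/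
def evalOneInvariants : (Rep.coind S.subtype B).ρ.invariants →ₗ[k] B.ρ.invariants where
  toFun f := ⟨((f : Rep.coind S.subtype B) : G → B) 1, apply_one_mem_invariants S B f.2⟩
  map_add' _ _ := rfl
  map_smul' _ _ := rfl

/-- The constant function with an `S`-invariant value is an element of `Coind_S^G B`.
[cite: Brown1982CohomologyGroups, VI (5.2)] -/
theorem const_mem_coindV (b : B.ρ.invariants) :
    (fun _ : G => (b : B)) ∈ Representation.coindV S.subtype B.ρ := fun s x => by
  simpa using (b.2 s).symm

/-- The constant function with value `b ∈ B^S`, as an element of `Coind_S^G B`. [folklore] -/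
def constCoind (b : B.ρ.invariants) : Rep.coind S.subtype B := ⟨fun _ => (b : B), const_mem_coindV S B b⟩

/-- … it is `G`-invariant. [cite: Brown1982CohomologyGroups, VI (5.2)] -/
theorem constCoind_mem_invariants (b : B.ρ.invariants) :
    constCoind S B b ∈ (Rep.coind S.subtype B).ρ.invariants := fun _ =>
  Subtype.ext (funext fun _ => rfl)

/-- **The constant-function map `B^S → (Coind_S^G B)^G`.** [cite: Brown1982CohomologyGroups, VI (5.2)] -/
def constInvariants : B.ρ.invariants →ₗ[k] (Rep.coind S.subtype B).ρ.invariants where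
  toFun b := ⟨constCoind S B b, constCoind_mem_invariants S B b⟩
  map_add' _ _ := rfl
  map_smul' _ _ := rfl

/-- **`(Coind_S^G B)^G ≅ B^S`** (evaluation at `1`, inverse: constant functions).
[cite: Brown1982CohomologyGroups, VI (5.2)] -/
def invariantsCoindEquiv : (Rep.coind S.subtype B).ρ.invariants ≃ₗ[k] B.ρ.invariants :=
  LinearEquiv.ofLinear (evalOneInvariants S B) (constInvariants S B)
    (LinearMap.ext fun _ => rfl)
    (LinearMap.ext fun f => Subtype.ext <| Subtype.ext <| funext fun x =>
      (coind_apply_eq_apply_one_of_mem_invariants S B f.2 x).symm)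

/-- Unfolding: `invariantsCoindEquiv f = f(1)`. [folklore] -/
@[simp] private theorem coe_invariantsCoindEquiv_apply (f : (Rep.coind S.subtype B).ρ.invariants) :
    ((invariantsCoindEquiv S B f : B.ρ.invariants) : B) =
      ((f : Rep.coind S.subtype B) : G → B) 1 := rfl

/-! ## §2 The norm: `(N_G f)(1) = Σ_{g ∈ G} f(g) = N_S (Σ_{q ∈ G/S} f(q̄⁻¹))` -/

section Fiber

/-- The fibre of `G → G/S` over `q` is in bijection with `S`: `g ↦ q̄⁻¹ g` (`q̄ = q.out`).
[folklore] -/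
def fiberEquivSubgroup (q : G ⧸ S) : {g : G // (g : G ⧸ S) = q} ≃ S where
  toFun g := ⟨q.out⁻¹ * g, QuotientGroup.eq.1 ((QuotientGroup.out_eq' q).trans g.2.symm)⟩
  invFun s := ⟨q.out * s, by
    have h : (q.out : G ⧸ S) = ((q.out * s : G) : G ⧸ S) :=
      QuotientGroup.eq.2 (by rw [inv_mul_cancel_left]; exact s.2)
    rw [← h, QuotientGroup.out_eq']⟩
  left_inv g := Subtype.ext (by simp)
  right_inv s := Subtype.ext (by simp)

/-- On the fibre over `q`: `f(g⁻¹) = (q̄⁻¹ g)⁻¹ · f(q̄⁻¹)` (`g⁻¹ = (q̄⁻¹ g)⁻¹ q̄⁻¹` with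
`q̄⁻¹ g ∈ S`). [cite: Brown1982CohomologyGroups, VI (5.2)] -/
theorem coind_apply_inv_of_fiber (f : Rep.coind S.subtype B) (q : G ⧸ S)
    (g : {g : G // (g : G ⧸ S) = q}) :
    (f : G → B) (g : G)⁻¹ = B.ρ (fiberEquivSubgroup S q g)⁻¹ ((f : G → B) q.out⁻¹) := by
  have hg : ((g : G))⁻¹ = (((fiberEquivSubgroup S q g)⁻¹ : S) : G) * q.out⁻¹ := by
    change ((g : G))⁻¹ = (q.out⁻¹ * (g : G))⁻¹ * q.out⁻¹
    rw [mul_inv_rev, inv_inv, mul_assoc, mul_inv_cancel, mul_one]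
  rw [hg, coind_apply_mul]

/-- The function supported on `S`, `x ↦ x · b` for `x ∈ S` and `0` off `S`. [folklore] -/
def indicatorFun [DecidablePred (· ∈ S)] (b : B) : G → B :=
  fun x => if hx : x ∈ S then B.ρ ⟨x, hx⟩ b else 0

/-- `indicatorFun b ∈ Coind_S^G B`. [cite: Brown1982CohomologyGroups, VI (5.2)] -/
theorem indicatorFun_mem_coindV [DecidablePred (· ∈ S)] (b : B) :
    indicatorFun S B b ∈ Representation.coindV S.subtype B.ρ := by
  intro s x
  by_cases hx : x ∈ S
  · have hsx : (s : G) * x ∈ S := S.mul_mem s.2 hx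
    simp only [indicatorFun, Subgroup.coe_subtype, dif_pos hx, dif_pos hsx]
    rw [← Module.End.mul_apply, ← map_mul]
    rfl
  · have hsx : (s : G) * x ∉ S := fun h => hx (by simpa using S.mul_mem (S.inv_mem s.2) h)
    simp only [indicatorFun, Subgroup.coe_subtype, dif_neg hx, dif_neg hsx, map_zero]

/-- `indicatorFun b` as an element of `Coind_S^G B`. [folklore] -/
def indicatorCoind [DecidablePred (· ∈ S)] (b : B) : Rep.coind S.subtype B :=
  ⟨indicatorFun S B b, indicatorFun_mem_coindV S B b⟩

end Fiber

section Norm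

variable [Fintype G]

/-- `(N_G f)(1) = Σ_{g ∈ G} f(g)`. [cite: Brown1982CohomologyGroups, VI (5.2)] -/
theorem coind_norm_apply_one (f : Rep.coind S.subtype B) :
    (((Rep.coind S.subtype B).ρ.norm f : Rep.coind S.subtype B) : G → B) 1 =
      ∑ g : G, (f : G → B) g := by
  rw [Representation.norm, LinearMap.sum_apply, Submodule.coe_sum, Finset.sum_apply]
  exact Finset.sum_congr rfl fun g _ => by rw [coind_ρ_apply, one_mul]

variable [DecidablePred (· ∈ S)]

/-- **`Σ_{g ∈ G} f(g) = N_S (Σ_{q ∈ G/S} f(q̄⁻¹))`** for `f ∈ Coind_S^G B` — the sum over `G`, coset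
by coset, lands in the norms from `S`. [cite: Brown1982CohomologyGroups, VI (5.2)] -/
theorem sum_apply_eq_norm [DecidableEq (G ⧸ S)] (f : Rep.coind S.subtype B) :
    ∑ g : G, (f : G → B) g = B.ρ.norm (∑ q : G ⧸ S, (f : G → B) q.out⁻¹) := by
  have h1 : ∑ g : G, (f : G → B) g = ∑ g : G, (f : G → B) g⁻¹ :=
    Fintype.sum_equiv (Equiv.inv G) _ _ fun g => by simp
  rw [h1, ← Fintype.sum_fiberwise (fun g : G => (g : G ⧸ S)) (fun g => (f : G → B) g⁻¹), map_sum]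
  refine Finset.sum_congr rfl fun q _ => ?_
  rw [Representation.norm, LinearMap.sum_apply,
    Fintype.sum_equiv (fiberEquivSubgroup S q) (fun g => (f : G → B) (g : G)⁻¹)
      (fun s => B.ρ s⁻¹ ((f : G → B) q.out⁻¹)) (fun g => coind_apply_inv_of_fiber S B f q g)]
  exact Fintype.sum_equiv (Equiv.inv S) _ _ fun s => rfl

/-- `Σ_{g ∈ G} (indicatorCoind b)(g) = N_S b`. [cite: Brown1982CohomologyGroups, VI (5.2)] -/
theorem sum_indicatorCoind (b : B) :
    ∑ g : G, (indicatorCoind S B b : G → B) g = B.ρ.norm b := by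
  change ∑ g : G, indicatorFun S B b g = _
  rw [Representation.norm, LinearMap.sum_apply]
  rw [← Finset.sum_subset (Finset.subset_univ (Finset.univ.filter (· ∈ S)))]
  · rw [Finset.sum_subtype (Finset.univ.filter (· ∈ S)) (p := (· ∈ S)) (by simp)]
    refine Finset.sum_congr rfl fun s _ => ?_
    simp only [indicatorFun, dif_pos s.2]
  · intro x _ hx
    rw [Finset.mem_filter, not_and] at hx
    simp only [indicatorFun, dif_neg (hx (Finset.mem_univ x))]

end Norm

/-! ## §3 `Ĥ⁰(G, Coind_S^G B) ≅ Ĥ⁰(S, B)` on the `coker N̄` carriers -/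

section Coker

variable [Fintype G] [DecidablePred (· ∈ S)]

/-- Evaluation at `1` carries `N_G(Coind_S^G B)` onto `N_S(B)` (inside the invariants).
[cite: Brown1982CohomologyGroups, VI (5.2)] -/
theorem map_invariantsCoindEquiv_range_normBar [DecidableEq (G ⧸ S)] :
    (LinearMap.range (normBar (Rep.coind S.subtype B).ρ)).map
        ((invariantsCoindEquiv S B : _ ≃ₗ[k] B.ρ.invariants) : _ →ₗ[k] B.ρ.invariants) =
      LinearMap.range (normBar B.ρ) := by
  ext b
  constructor
  · rintro ⟨y, hy, rfl⟩
    obtain ⟨f, hf⟩ := (mem_range_normBar_iff _ y).1 hy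
    refine (mem_range_normBar_iff _ _).2 ⟨∑ q : G ⧸ S, ((f : Rep.coind S.subtype B) : G → B) q.out⁻¹, ?_⟩
    rw [LinearEquiv.coe_coe, coe_invariantsCoindEquiv_apply, ← sum_apply_eq_norm, ← coind_norm_apply_one,
      hf]
  · intro hb
    obtain ⟨b', hb'⟩ := (mem_range_normBar_iff _ b).1 hb
    have hN : (Rep.coind S.subtype B).ρ.norm (indicatorCoind S B b') ∈
        (Rep.coind S.subtype B).ρ.invariants := norm_mem_invariants _ _
    refine ⟨⟨_, hN⟩, (mem_range_normBar_iff _ _).2 ⟨indicatorCoind S B b', rfl⟩, ?_⟩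
    apply Subtype.ext
    rw [LinearEquiv.coe_coe, coe_invariantsCoindEquiv_apply, ← hb']
    change (((Rep.coind S.subtype B).ρ.norm (indicatorCoind S B b') : Rep.coind S.subtype B) :
      G → B) 1 = _
    rw [coind_norm_apply_one, sum_indicatorCoind]

/-- **Shapiro's lemma in Tate degree `0`: `(Coind_S^G B)^G / N_G ≅ B^S / N_S`**, i.e.
`Ĥ⁰(G, Coind_S^G B) ≅ Ĥ⁰(S, B)` on the carriers `coker N̄` (Brown VI §4).
[cite: Brown1982CohomologyGroups, VI (5.2)] -/
def cokerNormBarCoindEquiv [DecidableEq (G ⧸ S)] :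
    ((Rep.coind S.subtype B).ρ.invariants ⧸ LinearMap.range (normBar (Rep.coind S.subtype B).ρ))
      ≃ₗ[k] (B.ρ.invariants ⧸ LinearMap.range (normBar B.ρ)) :=
  Submodule.Quotient.equiv _ _ (invariantsCoindEquiv S B)
    (map_invariantsCoindEquiv_range_normBar S B)

end Coker

end CoindShapiro

end Literature.Algebra.Homology
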